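import Mathlib
import HarnessLib
import HarnessLib.Audit
import Summits.RiemannHypothesis.Statement
import Summits.RiemannHypothesis.RiemannHypothesis.Theses.Strip
import HarnessLib.Audit.Status.Attr

/-!
Route: PrimeTwistCeiling

# Route PrimeTwistCeiling — uniform power saving for von Mangoldt twists on polynomial ranges plus
twisted Turan localisation gives a zero-free strip

It suffices to show X = K1 ∧ K2, plus the DECLARED RESIDUAL. K1 (PRIME-TWIST SAVING, prime side,
RH-free): there is ONE exponent
η ∈ (0,1) such that for every A ≥ 1 the twisted Chebyshev sum ψ(x,t) = Σ_(n≤x) Λ(n) n^(−it) equals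
its pole term x^(1−it)/(1−it) up to an
error ≤ x^(1−η), uniformly for |t| ≥ T₀(A) and |t| ≤ x ≤ |t|^A (a POWER saving on every polynomial
range; Vinogradov–Korobov gives only
exp(−c log x/(log|t|)^(2/3+ε))). K2 (TWISTED TURÁN LOCALISATION, zero-detection side): a zero ρ =
β+iγ with β ≥ 1−η/2 and |γ| ≥ T₁ forces
‖ψ(x,γ) − x^(1−iγ)/(1−iγ)‖ > x^(1−η) for some x ∈ [|γ|, |γ|^A] (Turán–Pintz power-sum localisation
transferred to the twist n^(−iγ), which moves ρ
to the real point β−i·0 of the shifted sum). K1 ∧ K2 and the finiteness of zeros below height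
max(T₀,T₁) (Mathlib, proved in the glue) give route
Strip's crux `Strip.StripZeroFreeStrip` (ζ ≠ 0 on 1−δ < Re s < 1) BY NAME — that implication is the
Assembly item, provable now; RH itself is
reached only through the declared residual `StripZeroFreeStrip → RH` (FRONTIER ledger, DensityLadder
precedent). W-02 row rh-idea-5, lens oqh.
Lean: `(∃ η : ℝ, 0 < η ∧ η < 1 ∧ ∀ A : ℝ, 1 ≤ A → ∃ T₀ : ℝ, 0 < T₀ ∧ ∀ t : ℝ, T₀ ≤ |t| → ∀ x : ℝ,
|t| ≤ x → x ≤ |t| ^ A → ‖(∑ n ∈ Finset.Icc 1 ⌊x⌋₊, ((ArithmeticFunction.vonMangoldt n : ℝ) : ℂ) * (n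
: ℂ) ^ (-((t : ℂ) * Complex.I))) - (x : ℂ) ^ (1 - (t : ℂ) * Complex.I) / (1 - (t : ℂ) * Complex.I)‖
≤ x ^ (1 - η)) ∧ (∀ η : ℝ, 0 < η → η < 1 → ∃ A : ℝ, 1 ≤ A ∧ ∃ T₁ : ℝ, 0 < T₁ ∧ ∀ ρ : ℂ, riemannZeta
ρ = 0 → 1 - η / 2 ≤ ρ.re → T₁ ≤ |ρ.im| → ∃ x : ℝ, |ρ.im| ≤ x ∧ x ≤ |ρ.im| ^ A ∧ x ^ (1 - η) < ‖(∑ n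
∈ Finset.Icc 1 ⌊x⌋₊, ((ArithmeticFunction.vonMangoldt n : ℝ) : ℂ) * (n : ℂ) ^ (-((ρ.im : ℂ) *
Complex.I))) - (x : ℂ) ^ (1 - (ρ.im : ℂ) * Complex.I) / (1 - (ρ.im : ℂ) * Complex.I)‖)`

## Assembly
Pure logic plus one Mathlib fact. From K1 take η and, for the A of K2(η), the threshold T₀; from
K2(η) take A, T₁. A zero ρ with Re ρ ≥ 1−η/2
and |Im ρ| ≥ max(T₀,T₁) would give an x ∈ [|Im ρ|, |Im ρ|^A] where the twisted error is
simultaneously > x^(1−η) (K2) and ≤ x^(1−η) (K1):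
contradiction; so all zeros of height ≥ max(T₀,T₁) have Re ρ < 1−η/2. Below that height the zeros
with 0 ≤ Re ρ ≤ 1 form a finite set (Mathlib
`IsCompact.inter_riemannZetaZeros_finite`; none has Re ρ ≥ 1 by `riemannZeta_ne_zero_of_one_le_re`),
so their real parts are ≤ θ₀ < 1; δ :=
min(1−θ₀, η/2) gives `Strip.StripZeroFreeStrip`. This implication is the Assembly item (PROVED in
the folder: g4/Sketch.lean
`stripZeroFreeStrip_of`, lean check rc 0, 0 sorry) and is a binder of the deciding theorem
`closes (h₁ : PrimeTwistSaving) (h₂ : TwistedTuranLocalisation) (hA : Assembly) (hR :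
PrimeTwistResidual) : Summit.RiemannHypothesis := hR (hA h₁ h₂)`.

Rationale: WHY THIS LINE. ORDER (II): the load-bearing input is the prime exponential sum Σ_(n≤x) Λ(n) n^(−it)
itself, not a zero count. The mechanism is Turán's
power-sum DUALITY (MontgomeryVaughan2007 §6.2 p.153: Turán 1950 used power sums to show CONVERSELY
that the ψ-error bound (6.27) implies the
zero-free region (6.24), with more general converse theorems by Stás 1961 and Pintz 1980/83/84; the
twisted-sum ⟺ quasi-RH criterion itself is in
Turán's 1984 book Part II, NOT HELD — erratum (c) of idea-crit-2 g1's verdict 2026-08-28T03:06:44Z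
accepted; Pintz 1980 Thm 2 and Révész arXiv:1912.00853
Thms 1–3 localise a single zero ρ₀ into a large oscillation of ψ(x)−x on x ∈ [X^(1/4), X] resp. [X,
X^(1+ε)]) used in the EMPTINESS direction: a prime-side saving kills zeros instead of counting them,
so the
line is tower-sighted where every density route (route-RiemannHypothesis-DensityLadder:
generic-coefficient large values → N(σ,T) counts,
capped at DH by LindelofBacklund) is tower-blind. Imported: Turán power-sum theory (diophantine
approximation / complex analysis), the explicit
formula, exponential sums over primes (Vinogradov, Vaughan/Heath-Brown identities,
IwaniecKowalski2004 §13). The open estimate typed as K1 is the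
author-named ceiling of the field: no pointwise POWER saving for Σ_(p∼P) p^(−it) at any polynomial
scale P = |t|^a is known (GuthMaynard2024
arXiv:2405.20552 p.28 remark and Guth's survey arXiv:2503.07410 treat only COUNTS of large values
with generic coefficients; Titchmarsh1986 §14.32,
§14.38). No spectral/probabilistic reformulation is used: the duality is already the natural
dictionary primes ↔ zeros.

RANKED CRUXES. #2 PrimeTwistSaving (crux) — K1 — one η ∈ (0,1) such that for every A ≥ 1 there is T₀
with ‖Σ_(n≤x) Λ(n) n^(−it) − x^(1−it)/(1−it)‖ ≤ x^(1−η) whenever |t| ≥ T₀ and |t| ≤ x ≤ |t|^A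
(uniform power saving for von Mangoldt twists on all polynomial ranges). [difficulty: open-problem]
(why it might fail: SAME WALL: by Turán 1950 / the explicit formula K1(η) sits between QRH(1−η) and
a zero-free strip, so no RH-free tool is in sight; as typed it is false only if zeros accumulate at
Re s = 1 (no strip) — then the whole line is dead anyway.) [MontgomeryVaughan2007, Titchmarsh1986,
IwaniecKowalski2004, arXiv:2405.20552, arXiv:2503.07410]
#3 TwistedTuranLocalisation (crux) — K2 — for every η ∈ (0,1) there are A ≥ 1 and T₁ such that every
zero ρ of ζ with Re ρ ≥ 1−η/2 and |Im ρ| ≥ T₁ produces some x ∈ [|Im ρ|, |Im ρ|^A] with x^(1−η) <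
‖Σ_(n≤x) Λ(n) n^(−i Im ρ) − x^(1−i Im ρ)/(1−i Im ρ)‖ (twisted Turán–Pintz localisation: one zero
forces a large twisted oscillation at a polynomially-related scale). [difficulty: L] (why it might
fail: Pintz/Révész localise for ψ(x)−x with X ≥ γ₀^(12000/ε³) and a loss γ₀^(1+ε); after the twist
the competing zeros ρ−iγ₀ crowd near 0 (≈ log γ₀ of them within distance 1), and the Turán loss
(C·count)^count may exceed any fixed power x^(η/2) unless A is huge — the quantifier ∃A must absorb
it.) [arXiv:1912.00853, MontgomeryVaughan2007, Titchmarsh1986, Ivic1985]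
#7 PrimeTwistResidual (crux) — RESIDUAL — declared T1′ conjunct complement, summit-strength BY
DESIGN, never a prover target, exempt from T3/T4, kind crux only because the deciding theorem may
assume crux items only (ruling 2026-08-16), ranked last: a zero-free vertical strip 1−δ < Re s < 1
(route Strip's crux, by name) implies RH. It names what the line does not reach (strip → critical
line), so that `closes` literally concludes `Summit.RiemannHypothesis` while the route lives on the
FRONTIER ledger. [deps: PrimeTwistSaving, TwistedTuranLocalisation] [difficulty: open-problem] (why
it might fail: it is summit-strength by design (a strip of width δ < 1/2 is far from Re s = 1/2; no
method converts a strip into the critical line); it is the declared residual, recorded on the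
summit's residual ledger, not a target.) [Bombieri2000, Titchmarsh1986]

TWO-LAYER PLAN. K1 ⇐ K1a → K1b → K1: K1a = twisted truncated explicit formula (‖err(x,t) + Σ_(|Im ρ
− t| ≤ x) x^(ρ−it)/(ρ−it)‖ ≤ x^(1−η)/2 on the range, a
theorem for every η < 1/2: Titchmarsh1986 §3, MontgomeryVaughan2007 §12.1 with s₀ = it), K1b = the
zero-side saving for the localised zero sum
(the honest open content), glue = triangle inequality. K2 ⇐ K2a → K2b → K2: K2a = twisted Pintz
theorem in print form (zero ρ₀, X ≥ |γ₀|^(A₀) ⇒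
∃ x ∈ [X, X²] with ‖err(x,γ₀)‖ > x^(β₀)·|γ₀|^(−C)), K2b = range/exponent fitting (real arithmetic:
β₀ ≥ 1−η/2 and x ≥ |γ₀|^(2C/η) ⇒ x^(β₀)|γ₀|^(−C) ≥ x^(1−η)).
Nothing of this is filed now; the birth skeletons bc/*_birth.lean carry exactly these stubs.

KILL CRITERIA. A refutation of TwistedTuranLocalisation as typed (e.g. a proof that the Turán loss
after twisting is super-polynomial for every A) forces a
pivot to the windowed form (x ∈ [X, X^(1+ε)] with X ≥ |γ|^(A₀(ε)), Révész Thm 3 shape) — restate,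
not close. A refutation of PrimeTwistSaving
(zeros accumulating at Re s = 1 infinitely often with the twisted sums large) closes the route
`refuted:PrimeTwistSaving` AND refutes route Strip's
StripZeroFreeStrip — informative either way. If route Strip's StripZeroFreeStrip is proved elsewhere
the RH-free part of this route is moot
(superseded); if DensityLadder's rungs close, nothing here changes (counts do not give K1).

NOT DECOMPOSED YET. The Vaughan / Heath-Brown identity split of K1 into type-I and type-II twisted
sums (the only prime-side attack shape known) is NOT filed: at a
single t the kernel (mn)^(−it) factorises and Cauchy–Schwarz returns the trivial bound, so the
type-II piece would carry the whole difficulty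
(shredding). Constants T₀, T₁, A are left existential; the η-dependence A(η) of K2 is not optimised;
no explicit-formula module is requested yet
(the tree has the t = 0 case only:
`Literature.NumberTheory.LFunctions.chebyshevPsi_isBigO_rpow_of_quasiRiemannHypothesis`).

CHEAPEST FALSIFIER. Exponent table (ran it, by hand + a 1-second local script): KNOWN pointwise
savings for Σ_(n≤x) Λ(n) n^(−it), |t| ≤ x ≤ |t|^A: Vinogradov–Korobov
x·exp(−c (log x)/(log|t|)^(2/3+ε)) (IwaniecKowalski2004 Cor 8.?; sub-power), Vinogradov type-I/II
x^(1−c/A²)-type savings only for x ≥ exp((log t)^2)-ranges — no x^(1−η) at polynomial scales: K1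
EXCEEDS everything known (so it is a genuine open estimate, not a port). Numerics (local, t = 10³
and 3·10³, x ∈ [t, t^1.3]): ‖err‖ ≈ x^0.51…0.66, far below x^0.75 — consistent with K1 for η = 1/4,
as RH predicts. The cheapest KILL is the Turán-loss count in K2: if ≥ c·log|γ| zeros lie within
distance 1 of ρ and the second main theorem's loss (8e·N/… )^N with N ≍ log|γ|·A is compared with
the gain x^(η/2) = |γ|^(aη/2), the inequality must close for some A — a one-page computation a
refuter can run this week (Révész arXiv:1912.00853 §3 does it untwisted with X ≥ γ₀^(12000 ε^(−3))).

NUMBERS. Zero-free regions known: classical c/log|t|; Vinogradov–Korobov c/((log|t|)^(2/3)(log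
log|t|)^(1/3)) (Ivic1985 Ch. 6; tree `Literature.NumberTheory.LFunctions.VinogradovKorobov`).
Turán-type converse: MontgomeryVaughan2007 p.153 — (6.27) ⇒ (6.24) (Turán 1950), Stás 1961, Pintz
1980/83/84; twisted criterion ⟺ quasi-RH: Turán 1984 Part II (not held). Pintz localisation: X ≥
γ₀^400, x ∈ [X^(1/4), X] (Pintz 1980, quoted arXiv:1912.00853 p.3 Thm 2); Révész: x ∈ [X, X^(1+ε)],
X ≥ γ₀^(12000/ε³), loss γ₀^(1+ε) (Thm 3). Density side for contrast: N(σ,T) ≪ T^(30(1−σ)/13+ε)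
(GuthMaynard2024), DH ceiling (tree TTY Thm 45).

DEFINITION REQUESTS. None at open. Foreseen (layer 2): a Literature module `TwistedExplicitFormula`
(truncated explicit formula for Σ_(n≤x) Λ(n) n^(−s₀), s₀ = it, MontgomeryVaughan2007 Thm 12.5 shape)
— requested only when K1a/K2a are filed.

Novelty: Searches (2026-08-28): lit search --hybrid "Turán power sum zeta zero-free region equivalent prime
sum" (hits: MontgomeryVaughan2007 p.153, Titchmarsh1986 p.280/283); lit vsearch "a single zero of
zeta forces a large oscillation of the Chebyshev function in a short range" (hit arXiv:1912.00853
p.3); lit read arXiv:2503.07410 / arXiv:2405.20552 / arXiv:2310.04544 / arXiv:2408.00617 /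
arXiv:2505.24017 / arXiv:2411.13791 --grep "prime|Λ|von Mangoldt|open" (no prime-supported
large-value statement; GM p.28 remark only); lit frontier RiemannHypothesis --since 2020 (density
successors, none prime-side); lean search
"vonMangoldt.*cpow|StripZeroFreeStrip|QuasiRiemannHypothesis" (tree: Strip.StripZeroFreeStrip,
StripBeatVinogradovKorobov, chebyshevPsi_isBigO_iff_forall_quasiRiemannHypothesis — all t = 0 or
zero-side); ledger negatives --problem RiemannHypothesis (5 entries, none on twisted prime sums).
Galaxy: "Turán's method|power sum method|twisted Chebyshev" — see NOTES (run at filing).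
Nearest prior art found: MontgomeryVaughan2007 §6.2 p.153 (Turán 1950: uniform bound (6.28) for Σ
Λ(n)n^(−it), N ≥ τ ⟺ quasi-RH) and arXiv:1912.00853 Thms 1–3 (Turán/Pintz/Révész localisation for
ψ(x)−x); in the tree, route-RiemannHypothesis-Strip (StripMertensPowerSaving: Σ μ(n)/n power saving
at t = 0 ⟹ strip — untwisted, global) and route-RiemannHypothesis-DensityLadder (counts).
Delta: the twist n^(−it) with x tied polynomially to |t| makes the prime-side hypothesis LOCAL in
height (each height'  [refs: 1912.00853, 2503.07410, 2405.20552, 2310.04544, 2408.00617, 2505.24017, 2411.13791, MontgomeryVaughan2007, Titchmarsh1986]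

Barriers (technique_class: explicit-formula, turan-power-sums, prime-exponential-sums): - technique_class: explicit-formula, turan-power-sums, prime-exponential-sums
- Literature.Barriers.RiemannHypothesis.BrouckeDebruyneRevesz2023_thm13: outside — the Beurling
counterexamples (DiamondMontgomeryVorhauer2006, Broucke–Debruyne–Révész 2023 Thm 1.3: regular
integers WITHOUT RH) say that no amount of integer-counting regularity forces a zero-free strip; the
hypothesis K1 is about the actual primes through Λ(n)n^(−it) at large height, not about N(x), and
such Beurling systems violate K1 itself (their twisted prime sums are large at the rogue ordinates)
— consistent with K1 being declared OPEN, not derived from anything integer-side.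
- Literature.Barriers.RiemannHypothesis.LindelofBacklund: outside — no ζ-size / moment /
large-values COUNT hypothesis is used; the line converts a prime-side saving into emptiness by Turán
duality, which is exactly the step LindelofBacklund says counts cannot make (this is why
DensityLadder is capped at DH and this line is not capped at DH — its cap is the strip, declared as
residual).
- Literature.Barriers.RiemannHypothesis.MollifierLimitations: does not apply — no mollifier, no mean
values.
- STANDARD v2 / T36 (tree theorem
Summit.RiemannHypothesis.RiemannHypothesis.Theorems.Splittings.TowerKillerStrip.stripZeroFreeStrip_of_kills_towersToOne):
inside by design — a tower-sighted RH-free line is ≥ Strip; priced: K1 is QRH-adjacent (SAME WALL),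
the route is born FRONTIER with the strip→RH residual declared.
- Negatives index: 5 refuted sta

sub-problem: RiemannHypothesis · status: draft · opened planner-rh-idea-5-g4-0 2026-08-28T02:43:57Z · rev 1 · ledger route-RiemannHypothesis-PrimeTwistCeiling
GENERATED by the gate from the ledger (D-0016/17). Provers cite these decls: `theorem foo : Summit.RiemannHypothesis.RiemannHypothesis.Theses.PrimeTwistCeiling.<Decl> := …` in Summits/RiemannHypothesis/RiemannHypothesis/Theorems/<Name>.lean.
-/

namespace Summit.RiemannHypothesis.RiemannHypothesis.Theses.PrimeTwistCeiling

open scoped BigOperators Topology Manifold Classical MeasureTheory ProbabilityTheory Matrix InnerProductSpace ComplexConjugate ContinuousMap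
open Filter Set Function TopologicalSpace MeasureTheory

attribute [summit_statement] _root_.Summit.RiemannHypothesis

open Summit

/-- item stmt-RiemannHypothesis-24925 · crux · rank 2 · open · by planner
why it might fail: SAME WALL: by Turán 1950 / the explicit formula K1(η) sits between QRH(1−η) and a zero-free strip, so no RH-free tool is in sight; as typed it is false only if zeros accumulate at Re s = 1 (no strip) — then the whole line is dead anyway.
sources: MontgomeryVaughan2007, Titchmarsh1986, IwaniecKowalski2004, arXiv:2405.20552, arXiv:2503.07410
[crux] K1 — one η ∈ (0,1) such that for every A ≥ 1 there is T₀ with ‖Σ_(n≤x) Λ(n) n^(−it) −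
x^(1−it)/(1−it)‖ ≤ x^(1−η) whenever |t| ≥ T₀ and |t| ≤ x ≤ |t|^A (uniform power saving for von
Mangoldt twists on all polynomial ranges). [difficulty: open-problem] -/
@[route_item "route-RiemannHypothesis-PrimeTwistCeiling", crux]
def PrimeTwistSaving : Prop :=
  ∃ η : ℝ, 0 < η ∧ η < 1 ∧ ∀ A : ℝ, 1 ≤ A → ∃ T₀ : ℝ, 0 < T₀ ∧ ∀ t : ℝ, T₀ ≤ |t| → ∀ x : ℝ, |t| ≤ x → x ≤ |t| ^ A → ‖(∑ n ∈ Finset.Icc 1 ⌊x⌋₊, ((ArithmeticFunction.vonMangoldt n : ℝ) : ℂ) * (n : ℂ) ^ (-((t : ℂ) * Complex.I))) - (x : ℂ) ^ (1 - (t : ℂ) * Complex.I) / (1 - (t : ℂ) * Complex.I)‖ ≤ x ^ (1 - η)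

/-- item stmt-RiemannHypothesis-24926 · crux · rank 3 · open · by planner
why it might fail: Pintz/Révész localise for ψ(x)−x with X ≥ γ₀^(12000/ε³) and a loss γ₀^(1+ε); after the twist the competing zeros ρ−iγ₀ crowd near 0 (≈ log γ₀ of them within distance 1), and the Turán loss (C·count)^count may exceed any fixed power x^(η/2) unless A is huge — the quantifier ∃A must absorb it.
sources: arXiv:1912.00853, MontgomeryVaughan2007, Titchmarsh1986, Ivic1985
[crux] K2 — for every η ∈ (0,1) there are A ≥ 1 and T₁ such that every zero ρ of ζ with Re ρ ≥ 1−η/2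
and |Im ρ| ≥ T₁ produces some x ∈ [|Im ρ|, |Im ρ|^A] with x^(1−η) < ‖Σ_(n≤x) Λ(n) n^(−i Im ρ) −
x^(1−i Im ρ)/(1−i Im ρ)‖ (twisted Turán–Pintz localisation: one zero forces a large twisted
oscillation at a polynomially-related scale). [difficulty: L] -/
@[route_item "route-RiemannHypothesis-PrimeTwistCeiling", crux]
def TwistedTuranLocalisation : Prop :=
  ∀ η : ℝ, 0 < η → η < 1 → ∃ A : ℝ, 1 ≤ A ∧ ∃ T₁ : ℝ, 0 < T₁ ∧ ∀ ρ : ℂ, riemannZeta ρ = 0 → 1 - η / 2 ≤ ρ.re → T₁ ≤ |ρ.im| → ∃ x : ℝ, |ρ.im| ≤ x ∧ x ≤ |ρ.im| ^ A ∧ x ^ (1 - η) < ‖(∑ n ∈ Finset.Icc 1 ⌊x⌋₊, ((ArithmeticFunction.vonMangoldt n : ℝ) : ℂ) * (n : ℂ) ^ (-((ρ.im : ℂ) * Complex.I))) - (x : ℂ) ^ (1 - (ρ.im : ℂ) * Complex.I) / (1 - (ρ.im : ℂ) * Complex.I)‖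

/-- item stmt-RiemannHypothesis-24927 · crux · rank 7 · open · by planner
why it might fail: it is summit-strength by design (a strip of width δ < 1/2 is far from Re s = 1/2; no method converts a strip into the critical line); it is the declared residual, recorded on the summit's residual ledger, not a target.
sources: Bombieri2000, Titchmarsh1986
[crux] RESIDUAL — declared T1′ conjunct complement, summit-strength BY DESIGN, never a prover
target, exempt from T3/T4, kind crux only because the deciding theorem may assume crux items only
(ruling 2026-08-16), ranked last: a zero-free vertical strip 1−δ < Re s < 1 (route Strip's crux, by
name) implies RH. It names what the line does not reach (strip → critical line), so that `closes`
literally concludes `Summit.RiemannHypothesis` while the route lives on the FRONTIER ledger. [deps: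
PrimeTwistSaving, TwistedTuranLocalisation] [difficulty: open-problem] -/
@[route_item "route-RiemannHypothesis-PrimeTwistCeiling", crux]
def PrimeTwistResidual : Prop :=
  Summit.RiemannHypothesis.RiemannHypothesis.Theses.Strip.StripZeroFreeStrip → Summit.RiemannHypothesis

/-- item stmt-RiemannHypothesis-24928 · assembly · rank 1 · closed · proved by Summit.RiemannHypothesis.RiemannHypothesis.Theorems.PrimeTwistCeilingAssembly.assembly_proof (planner) · by planner
sources: MontgomeryVaughan2007, Titchmarsh1986
[assembly] PrimeTwistSaving → TwistedTuranLocalisation → route Strip's crux StripZeroFreeStrip (the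
RH-free content of the line, bearing on stmt `Strip.StripZeroFreeStrip` by name); with the residual,
→ RH. -/
@[route_item "route-RiemannHypothesis-PrimeTwistCeiling", crux]
def Assembly : Prop :=
  PrimeTwistSaving → TwistedTuranLocalisation → Summit.RiemannHypothesis.RiemannHypothesis.Theses.Strip.StripZeroFreeStrip

-- `Assembly` holds: proved by `Summit.RiemannHypothesis.RiemannHypothesis.Theorems.PrimeTwistCeilingAssembly.assembly_proof` (its module imports this route file, so no `_holds` link can be stated here).

/-! D-0027 §2.1 — DECIDING THEOREM (planner-authored via `route open/edit --closes-file`; by planner-rh-idea-5-g4-0 2026-08-28T02:43:57Z):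
its hypotheses are this route's items and its conclusion the sub-problem Statement (glue_lint), and it elaborates with this file. -/

@[closes "route-RiemannHypothesis-PrimeTwistCeiling"] theorem closes (h₁ : PrimeTwistSaving) (h₂ : TwistedTuranLocalisation) (hA : Assembly)
    (hR : PrimeTwistResidual) : Summit.RiemannHypothesis :=
  hR (hA h₁ h₂)

end Summit.RiemannHypothesis.RiemannHypothesis.Theses.PrimeTwistCeiling
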